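import Summits.NavierStokesRegularity.NavierStokesRegularity.Theses.TerminalTrace
import Summits.NavierStokesRegularity.NavierStokesRegularity.Theorems.TerminalTraceTypeITraceScarL3OfNoSpreadExtinctApex
import Summits.NavierStokesRegularity.NavierStokesRegularity.Theorems.TerminalTraceTypeITraceScarL3SqrtTwoApexWindow
import Summits.NavierStokesRegularity.NavierStokesRegularity.Theorems.TerminalTraceTypeITraceScarL3RadiusDichotomy
import Summits.NavierStokesRegularity.NavierStokesRegularity.Theorems.TerminalTraceTypeITraceScarL3LateBoundedLiouville
import Summits.NavierStokesRegularity.NavierStokesRegularity.Theorems.TerminalTraceTypeITraceScarL3CaseTwoZoom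
import Summits.NavierStokesRegularity.NavierStokesRegularity.Theorems.TerminalTraceTypeITraceScarL3HalfSpaceLiouville
import Summits.NavierStokesRegularity.NavierStokesRegularity.Theorems.TerminalTraceTypeITraceScarL3CaseOneZoom
import Literature.Analysis.FluidPDE.LocalTypeI
import HarnessLib

/-!
# Item `TerminalTrace.TypeITraceScarL3` (stmt-NavierStokesRegularity-18385) — PROVED by the line `radius_dichotomy`
# (crux chain `Cruxes/TypeITraceScarL3/Lines/radius_dichotomy_CANDIDATE.lean`, registered by nsreg-p2 g33; lead of the line
# nsreg-C26-p1 g5, cell ns-regularity-ideate)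

`terminalTrace_typeITraceScarL3_proof : Summit.NavierStokesRegularity.NavierStokesRegularity.Theses.TerminalTrace.TypeITraceScarL3`.

THE ARGUMENT. An extinct Type-I apex (a local energy ancient solution in the local Type-I class `(M, D₀, C)` — suitable in
every `Q_a(0)`, `𝐈 ≤ M`, `D ≤ D₀`, the a.e. rate `C/√(-s)`, weakly vanishing at the top time) is NEVER backward-singular at the
origin (`TypeITraceScarL3.no_singular_extinctApex`):  by the regularity-radius dichotomy (`radiusDichotomy`, Z3) either
CASE 2 — the radius is comparable to the distance to the top singular set; the top singular set is `μH[1]`-null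
(`hausdorffMeasure_topSingular_apex_eq_zero`), so a regular top point exists, and the zoom at the nearest singular point is a
non-trivial class member bounded on a late half-space slab (`caseTwoZoom`, Z5), which the half-space Liouville theorem
(`halfSpaceLiouville`, Z2: ESS half-space backward uniqueness + unique continuation + bounded Liouville) annihilates — or
CASE 1 — the zooms at nearly-minimal regular points converge to a non-trivial class member bounded on a late whole-space slab
(`caseOneZoom`, Z4), which the late bounded Liouville theorem (`lateBoundedLiouville`, Z1: ESS endgame + time shifts)
annihilates.  The item follows BY NAME through the landed reduction `typeITraceScarL3_of_no_spreadExtinctApex` (p585751).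
WHAT THIS IS NOT: a proof of Navier–Stokes regularity; only the support item `TypeITraceScarL3` of route `TerminalTrace`.
[cite: EscauriazaSereginSverak2003, §3, Thms. 4.1, 5.1] [cite: Seregin2014, §6.6] [cite: AlbrittonBarker2019, §2]
-/

set_option linter.dupNamespace false

noncomputable section

open MeasureTheory Set Function Filter Topology Metric
open scoped NNReal ENNReal InnerProductSpace RealInnerProductSpace

namespace Summit.NavierStokesRegularity.NavierStokesRegularity.Theorems

open Literature.Analysis.FluidPDE
open Summit.NavierStokesRegularity.NavierStokesRegularity.Theorems.TypeITraceScarL3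

/-- A set of `ℝ³` of one-dimensional Hausdorff measure zero is not all of `ℝ³`: the whole space is closed and meets
every shell about the origin, so `μH[1] ℝ³ ≠ 0` (`hausdorffMeasure_ne_zero_of_meets_every_shell`). [folklore] -/
theorem TypeITraceScarL3.exists_not_mem_of_hausdorffMeasure_one_eq_zero {S : Set (EuclideanSpace ℝ (Fin 3))}
    (hS : μH[1] S = 0) : ∃ y : EuclideanSpace ℝ (Fin 3), y ∉ S := by
  by_contra h
  simp only [not_exists, not_not] at h
  have huniv : S = univ := eq_univ_of_forall h
  rw [huniv] at hS
  refine hausdorffMeasure_ne_zero_of_meets_every_shell isClosed_univ (0 : EuclideanSpace ℝ (Fin 3)) ?_ hS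
  intro R hR _ A hA
  obtain ⟨v, hv⟩ := exists_norm_eq (EuclideanSpace ℝ (Fin 3)) hR.le
  refine ⟨v, mem_univ _, ?_, ?_⟩
  · rw [sub_zero, hv]
  · rw [sub_zero, hv]
    nlinarith

/-- **NO EXTINCT TYPE-I APEX IS BACKWARD-SINGULAR AT THE ORIGIN** (the composition of the line `radius_dichotomy`;
see the module docstring). [cite: EscauriazaSereginSverak2003, §3] [cite: Seregin2014, §6.6] -/
theorem TypeITraceScarL3.no_singular_extinctApex
    (U : ℝ → EuclideanSpace ℝ (Fin 3) → EuclideanSpace ℝ (Fin 3))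
    (P : ℝ → EuclideanSpace ℝ (Fin 3) → ℝ)
    (G : ℝ → EuclideanSpace ℝ (Fin 3) →
      EuclideanSpace ℝ (Fin 3) →L[ℝ] EuclideanSpace ℝ (Fin 3))
    (M D₀ : ℝ≥0) (C : ℝ)
    (hsw : ∀ a : ℝ, 0 < a →
      IsSuitableWeakSolutionInBall a (0 : ℝ × EuclideanSpace ℝ (Fin 3)) U P)
    (hG : ∀ a : ℝ, 0 < a →
      HasWeakSpatialGradientOn
        (parabolicCylinderOpens a (0 : ℝ × EuclideanSpace ℝ (Fin 3))) U G)
    (hI : ∀ a : ℝ, 0 < a →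
      typeIBound (parabolicCylinder a (0 : ℝ × EuclideanSpace ℝ (Fin 3))) U P G ≤ M)
    (hD : ∀ z₀ : ℝ × EuclideanSpace ℝ (Fin 3), z₀.1 ≤ 0 →
      ∀ r : ℝ, 0 < r → cknD r z₀ P ≤ D₀)
    (hrate : ∀ s : ℝ, s < 0 →
      ∀ᵐ y : EuclideanSpace ℝ (Fin 3), ‖U s y‖ ≤ C / Real.sqrt (-s))
    (htop : ∀ φ : EuclideanSpace ℝ (Fin 3) → EuclideanSpace ℝ (Fin 3),
      ContDiff ℝ (⊤ : ℕ∞) φ →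
      HasCompactSupport φ → ∀ ε : ℝ, 0 < ε →
      ∃ s₀ : ℝ, s₀ < 0 ∧ ∀ᵐ s ∂(volume.restrict (Ioo s₀ 0)), |∫ y, ⟪U s y, φ y⟫| ≤ ε) :
    ¬ IsBackwardSingularPoint U (0 : ℝ × EuclideanSpace ℝ (Fin 3)) := by
  intro hsing
  rcases radiusDichotomy U with ⟨c₀, hc₀, hcase2⟩ | hcase1
  · -- CASE 2: a regular top point exists by CKN at the top
    obtain ⟨y₁, hy₁⟩ := TypeITraceScarL3.exists_not_mem_of_hausdorffMeasure_one_eq_zero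
      (hausdorffMeasure_topSingular_apex_eq_zero hsw)
    obtain ⟨M', D₀', C', V, Q, H, hV, hH, hIV, hDV, hrV, htV, hhalf, hne⟩ :=
      caseTwoZoom U P G M D₀ C hsw hG hI hD hrate htop hsing ⟨y₁, hy₁⟩ ⟨c₀, hc₀, hcase2⟩
    exact hne (halfSpaceLiouville V Q H M' D₀' C' hV hH hIV hDV hrV htV hhalf 1 one_pos)
  · -- CASE 1
    obtain ⟨M', D₀', C', V, Q, H, hV, hH, hIV, hDV, hrV, htV, hlate, hne⟩ :=
      caseOneZoom U P G M D₀ C hsw hG hI hD hrate htop hcase1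
    exact hne (lateBoundedLiouville V Q H M' D₀' C' hV hH hIV hDV hrV htV
      ⟨1 / 16, by norm_num, 4, hlate⟩ 3 (by norm_num))

/-- **Item `TerminalTrace.TypeITraceScarL3` (stmt-NavierStokesRegularity-18385), BY NAME**: Stub C of the line
`apex-dichotomy` holds with its SPREAD hypothesis unused (`TypeITraceScarL3.no_singular_extinctApex`), and the landed
reduction `typeITraceScarL3_of_no_spreadExtinctApex` concludes. [cite: EscauriazaSereginSverak2003, §3] -/
theorem terminalTrace_typeITraceScarL3_proof :
    Summit.NavierStokesRegularity.NavierStokesRegularity.Theses.TerminalTrace.TypeITraceScarL3 :=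
  typeITraceScarL3_of_no_spreadExtinctApex fun U P G M D₀ C hsw hG hI hD hrate htop _ =>
    TypeITraceScarL3.no_singular_extinctApex U P G M D₀ C hsw hG hI hD hrate htop

end Summit.NavierStokesRegularity.NavierStokesRegularity.Theorems

end
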